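import Literature.AlgebraicGeometry.Motives.UniversalHypersurfaceRegularLocus
import Literature.AlgebraicGeometry.Motives.UniversalHypersurfaceQuasiProjective
import Literature.AlgebraicGeometry.HodgeTheory.UniversalHypersurfaceEhresmann
import Literature.AlgebraicGeometry.Motives.ComplexPointsSubmersion
import HarnessLib

/-!
# Topology of the complex manifold `𝒴°(ℂ)` of the regular locus: Hausdorff, second countable, σ-compact

Family `hodge`, layer `Literature/AlgebraicGeometry/Motives`; sequel of `UniversalHypersurfaceRegularLocus` (`𝒴° = regularTotal k n d`,
the regular locus of the universal hypersurface, smooth over `k` of relative dimension `n + N`) and `UniversalHypersurfaceQuasiProjective`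
(`totalSpaceOver k n d`, the universal hypersurface `𝒴 ⊆ ℙⁿ⁺¹ × S^d` as a `k`-scheme). The differential-topological constructions on
`𝒴°(ℂ)` (lifting vector fields by partitions of unity, `Geometry/Manifold/SubmersionLiftVectorField`; programme discharging
`HodgeTheory/CyclicCoverNodalMeridianLocalMonodromyBound`) need `𝒴°(ℂ)` to be a Hausdorff σ-compact `C^∞` manifold:

* `regularToTotalSpaceOver : 𝒴° ⟶ 𝒴` — the open immersion of `k`-schemes (`regularLocus.ι` over `S^d`);
  `isOpenEmbedding_map_regularToTotalSpaceOver`, `isOpenEmbedding_map_totalToRegular` — `𝒴°(L) ↪ 𝒴(L)` and `𝒴_U(L) ↪ 𝒴°(L)` are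
  open embeddings (`AlgPoints.isOpenEmbedding_map_holds`, SGA1 XII Prop. 3.1 (xi));
* `compactSpace_totalSpace`, `secondCountableTopology_totalSpaceOver`, `secondCountableTopology_regularTotal` — `𝒴` is quasi-compact
  (proper over the affine `S^d`), so `𝒴(ℂ)` is second countable (Serre GAGA §2: finitely many charts), hence so is its open subset `𝒴°(ℂ)`;
* `t2Space_regularTotal` (`𝒴°` is separated), `locallyCompactSpace_regularTotal`, `sigmaCompactSpace_regularTotal` (a second countable
  manifold; `d ≥ 1`).

Everything is proved; the one definition (`regularToTotalSpaceOver`) is concrete; no named facts.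

## References

* [SGA1] A. Grothendieck, M. Raynaud, SGA 1, Exp. XII Thm. 1.1 (proof a)) and Prop. 3.1 (xi).
* [SerreGAGA1956] J.-P. Serre, Géométrie algébrique et géométrie analytique, Ann. Inst. Fourier 6 (1956), §2 n°5 (p. 9).
* [VoisinHodgeII2003] C. Voisin, Hodge Theory and Complex Algebraic Geometry II (2003), §6.2.1.
-/

noncomputable section

open CategoryTheory AlgebraicGeometry TopologicalSpace Topology
open scoped Manifold ContDiff

universe u

namespace Literature.AlgebraicGeometry.Motives.UniversalHypersurface

/-! ### The open immersions `𝒴_U ↪ 𝒴° ↪ 𝒴` on points -/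

section Scheme

variable (k : Type u) [Field k] (n d : ℕ)

/-- **The open immersion `𝒴° ↪ 𝒴` of `k`-schemes** (`regularLocus.ι`, over `S^d → Spec k`). [cite: VoisinHodgeII2003, §6.2.1] -/
def regularToTotalSpaceOver : regularTotal k n d ⟶ totalSpaceOver k n d :=
  Over.homMk (regularLocus k n d).ι rfl

/-- The underlying morphism of `regularToTotalSpaceOver` is `regularLocus.ι` (`rfl`). [cite: VoisinHodgeII2003, §6.2.1] -/
theorem regularToTotalSpaceOver_left : (regularToTotalSpaceOver k n d).left = (regularLocus k n d).ι := rfl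

/-- `𝒴° ↪ 𝒴` is an open immersion. [cite: VoisinHodgeII2003, §6.2.1] -/
theorem isOpenImmersion_regularToTotalSpaceOver_left : IsOpenImmersion (regularToTotalSpaceOver k n d).left :=
  inferInstanceAs (IsOpenImmersion (regularLocus k n d).ι)

variable {L : Type u} [Field L] [Algebra k L] [TopologicalSpace L]

/-- **`𝒴°(L) ↪ 𝒴(L)` is an open embedding** for the strong topologies. [cite: SGA1, Exp. XII Prop. 3.1 (xi)] -/
theorem isOpenEmbedding_map_regularToTotalSpaceOver :
    IsOpenEmbedding (AlgPoints.map (regularToTotalSpaceOver k n d) : AlgPoints (regularTotal k n d) L → _) :=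
  haveI := isOpenImmersion_regularToTotalSpaceOver_left k n d
  AlgPoints.isOpenEmbedding_map_holds (regularToTotalSpaceOver k n d)

/-- **`𝒴_U(L) ↪ 𝒴°(L)` is an open embedding** for the strong topologies. [cite: SGA1, Exp. XII Prop. 3.1 (xi)] -/
theorem isOpenEmbedding_map_totalToRegular :
    IsOpenEmbedding (AlgPoints.map (totalToRegular k n d) : AlgPoints (total k n d) L → _) :=
  AlgPoints.isOpenEmbedding_map_holds (totalToRegular k n d)

/-- `𝒴 = V₊(F)` is quasi-compact (proper over the affine scheme `S^d`). [cite: Hartshorne1977, II Thm. 4.9] -/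
theorem compactSpace_totalSpace : CompactSpace (totalSpace k n d) :=
  haveI : UniversallyClosed (totalToSpec k n d) :=
    @IsProper.toUniversallyClosed _ _ (totalToSpec k n d) (isProper_totalToSpec k n d)
  haveI : QuasiCompact (totalToSpec k n d) := inferInstance
  QuasiCompact.compactSpace_of_compactSpace (totalToSpec k n d)

/-- `𝒴 → Spec k` is locally of finite type. [cite: VoisinHodgeII2003, §6.2.1] -/
theorem locallyOfFiniteType_totalSpaceOver_hom : LocallyOfFiniteType (totalSpaceOver k n d).hom := by
  haveI h1 : LocallyOfFiniteType (specCoeffToSpec k n d) :=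
    HodgeTheory.UniversalHypersurface.locallyOfFiniteType_specCoeffToSpec k n d
  haveI h2 : LocallyOfFiniteType (totalToSpec k n d) :=
    @IsProper.toLocallyOfFiniteType _ _ (totalToSpec k n d) (isProper_totalToSpec k n d)
  change LocallyOfFiniteType (totalToSpec k n d ≫ specCoeffToSpec k n d)
  exact MorphismProperty.comp_mem _ _ _ h2 h1

end Scheme

/-! ### `𝒴°(ℂ)`: second countable, Hausdorff, σ-compact -/

section Complex

variable (n d : ℕ)

/-- `𝒴(ℂ)` is second countable (`𝒴` quasi-compact of finite type: finitely many charts, Serre GAGA §2).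
[cite: SerreGAGA1956, §2 n°5 (p. 9)] -/
theorem secondCountableTopology_totalSpaceOver : SecondCountableTopology (ComplexPoints (totalSpaceOver ℂ n d)) := by
  haveI := locallyOfFiniteType_totalSpaceOver_hom ℂ n d
  haveI : CompactSpace (totalSpaceOver ℂ n d).left := compactSpace_totalSpace ℂ n d
  exact ComplexPoints.secondCountableTopology_of_compactSpace_holds _

/-- **`𝒴°(ℂ)` is second countable** (an open subset of `𝒴(ℂ)`). [cite: SerreGAGA1956, §2 n°5 (p. 9)] -/
theorem secondCountableTopology_regularTotal : SecondCountableTopology (ComplexPoints (regularTotal ℂ n d)) :=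
  haveI := secondCountableTopology_totalSpaceOver n d
  (isOpenEmbedding_map_regularToTotalSpaceOver ℂ n d (L := ℂ)).isEmbedding.secondCountableTopology

/-- **`𝒴°(ℂ)` is Hausdorff** (`𝒴°` is separated over `ℂ`). [cite: SerreGAGA1956, §2 n°5] -/
theorem t2Space_regularTotal : T2Space (ComplexPoints (regularTotal ℂ n d)) :=
  haveI := isSeparated_regularTotal_hom ℂ n d
  ComplexPoints.t2Space_of_isSeparated _

/-- `𝒴°(ℂ)` is locally compact (a manifold; `d ≥ 1`). [cite: SerreGAGA1956, §2 n°5] -/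
theorem locallyCompactSpace_regularTotal (hd : 0 < d) : LocallyCompactSpace (ComplexPoints (regularTotal ℂ n d)) := by
  haveI := locallyOfFiniteType_regularTotal_hom ℂ n d hd
  haveI := smoothOfRelativeDimension_regularTotal_hom ℂ n d hd
  letI := ComplexPoints.chartedSpace (regularTotal ℂ n d) (n + Fintype.card (DegIndex n d))
  exact ChartedSpace.locallyCompactSpace (EuclideanSpace ℝ (Fin (2 * (n + Fintype.card (DegIndex n d))))) _

/-- **`𝒴°(ℂ)` is σ-compact** (second countable and locally compact; `d ≥ 1`). [cite: SerreGAGA1956, §2 n°5] -/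
theorem sigmaCompactSpace_regularTotal (hd : 0 < d) : SigmaCompactSpace (ComplexPoints (regularTotal ℂ n d)) := by
  haveI := locallyCompactSpace_regularTotal n d hd
  haveI := secondCountableTopology_regularTotal n d
  infer_instance

end Complex

end Literature.AlgebraicGeometry.Motives.UniversalHypersurface

end
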